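import Summits.NavierStokesRegularity.NavierStokesRegularity.Theorems.ExtremiserTransiencePlateauSliceRigidity
import Summits.NavierStokesRegularity.NavierStokesRegularity.Theorems.ExtremiserTransienceKStarAttainedHalfSpaceVariation
import Summits.NavierStokesRegularity.NavierStokesRegularity.Theorems.ExtremiserTransienceKStarAttainedDensity
import Summits.NavierStokesRegularity.NavierStokesRegularity.Theorems.ExtremiserTransienceKStarAttainedEulerLagrange
import HarnessLib

/-!
# Crux `NearExtremalTransiencePerFlow` (stmt-NavierStokesRegularity-26567) — LINE g6-γ «bang-bang core»
# (seat ns-idea-5 g6, technique: extremal-example mining): a CHECKED SKELETON whose registered stubs are the proof plan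
# of the rev-21 crux `RegularisedNearPlateauStability` (28317)

Target BY NAME: `…Theses.ExtremiserTransience.NearExtremalTransiencePerFlow`, through the PROVED intermediate composition
`RegularisedNearPlateauStability_of : K2 → K3 → K14 → RegularisedNearPlateauStability` (28317 BY NAME) and the route's support item
`RegularisedSliceTransfer` (28318, hypothesis BY NAME; its own skeleton is LINE g6-β `Lines/regularised_transfer.lean`), ex falso via
the landed `plateauSliceRigidity` (27823).

THE MECHANISM (quantitative bang-bang for near-maximisers of `|J|/(κ⋆ M √Z √W)` in the parabolic-regular class
`‖Dʲv‖ ≤ A_j M λ^{-j}`, `λ = √(Z/W)`).  Write `f(s) = J(v+sφ)² − κ⋆² M² Z(v+sφ) W(v+sφ)`; universality of `κ⋆` gives `f ≤ 0`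
whenever `‖v+sφ‖ ≤ M`, near-efficiency gives `f(0) ≥ −2κ⋆ε M²ZW`.  Its linear coefficient along `φ = curl η` is the FIRST VARIATION
`ℓ_v(curl η) = 2J·J₁ − 2κ⋆²M²(W·A₁ + Z·C₁) = ∫⟪G, η⟫` with the landed Euler–Lagrange DENSITY `G` (`KStar.exists_density`,
`density_formula`: six derivatives of `v`, coefficients `2J, −2κ⋆²M²W, −2κ⋆²M²Z`).
* `stub_densitySupBound` (K2, M/L): in the A-regular class `‖G‖_∞ ≤ C_G(A)·M³·W·λ^{-3}` (explicit formula + `|J| ≤ κ⋆M√Z√W`).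
* `stub_efficientCore` (K3, the OPEN heart, L): an (κ⋆−ε₀)-efficient A-regular field has an EFFICIENT CORE: a ball `B(x₀, R₀(A)λ)` and
  a test potential `η ∈ C_c^∞(B)`, `‖Dʲη‖ ≤ D_j M λ^{1−j}`, with `ℓ_v(curl η) ≥ σ₀(A)·M⁴Wλ` (positivity is global —
  `ℓ_v(v) = 6J² − 4κ⋆²M²ZW ≥ 2κ⋆²M²ZW(1 − 6ε/κ⋆)`, the sup-norm constraint is ACTIVE with definite multiplier mass — the stub
  LOCALISES it at scale λ despite the gauge error of local vector potentials; why it might fail: diffuse near-maximisers).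
* `stub_localBangBang` (K1 + K4, M/L): SLACK FERMAT (`|ℓ_v(curl η')| ≤ C(√ε+ε)/τ⁸ · M⁴Wλ` for `η'` supported in `{‖v‖ < (1−2τ)M}`,
  from `f ≤ 0` on `|s| ≤ s₀`, `f(0) ≥ −2κ⋆εM²ZW` and Taylor coefficients bounded by A, D) + the LEVEL-SET SPLIT `η = ηζ_τ + η(1−ζ_τ)`
  (`ζ_τ` a smooth cutoff of `‖v‖²/M²` at the levels `1−3τ, 1−2τ`): `σ M⁴Wλ ≤ ℓ_v(curl η) ≤ ‖G‖_∞ ‖η‖_∞ vol(B ∩ {‖v‖ ≥ (1−3τ)M}) + slack`,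
  i.e. `vol ≥ λ³ (σ − C_K(√ε+ε)/τ⁸)/C_K`.
Composition (kernel-checked): `c₀ = σ₀/(2 C_K R₀³)`, `r = R₀`, `τ = min δ (3/4) / 3`, `ε = min (min ε₀ 1) (σ₀τ⁸/(4C_K))²`.
HONEST FRAMING: implications between OPEN statements about near-maximisers of one scale-invariant functional and hypothetical
Type-I singular flows; nothing about Navier–Stokes regularity or blow-up is proved here; no summit is proved by a line.
-/

noncomputable section

open scoped Topology InnerProductSpace RealInnerProductSpace ENNReal ContDiff
open MeasureTheory Filter Set Metric
open Literature.Analysis.FluidPDE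
open Summit.NavierStokesRegularity.NavierStokesRegularity.Theses.ExtremiserTransience
open Summit.NavierStokesRegularity.NavierStokesRegularity.Theorems.DepletionLadder.KStar
open Summit.NavierStokesRegularity.NavierStokesRegularity.Theorems.DepletionLadder.KStar.HalfSpace

namespace Summit.NavierStokesRegularity.NavierStokesRegularity.Cruxes.NearExtremalTransiencePerFlow.BangBangCore

set_option linter.dupNamespace false
set_option linter.unusedVariables false

/-! ## §0 Vocabulary (abbreviations over the tree's `KStar.HalfSpace` definitions `kStar, Jst, Zen, Wpa, J1, A1, C1`) -/

/-- The Taylor-type length `λ(v) = √(Z/W)`. -/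
def lam (v : E3 → E3) : ℝ := Real.sqrt (Zen v / Wpa v)

/-- FIRST VARIATION of `f(s) = J(v+sφ)² − κ⋆²M²Z(v+sφ)W(v+sφ)` at `s = 0` along `φ`
(`Z(v+sφ) = Z + 2sA₁ + …`, `W(v+sφ) = W + 2sC₁ + …`, `J(v+sφ) = J + sJ₁ + …`). -/
def ell (v : E3 → E3) (M : ℝ) (φ : E3 → E3) : ℝ :=
  2 * Jst v * J1 v φ - 2 * kStar ^ 2 * M ^ 2 * (Wpa v * A1 v φ + Zen v * C1 v φ)

/-- The admissible class of the route's set `V` (smooth, divergence-free, `‖v‖ ≤ M`, `‖∇v‖ ≤ B`, `H⁰, H¹, H²` finite). -/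
def IsAdm (v : E3 → E3) (M B : ℝ) : Prop :=
  ContDiff ℝ (⊤ : ℕ∞) v ∧ VectorCalculus.IsDivFree v ∧ (∀ x, ‖v x‖ ≤ M) ∧ (∀ x, ‖fderiv ℝ v x‖ ≤ B) ∧
    (∫⁻ x, ‖iteratedFDeriv ℝ 0 v x‖ₑ ^ 2 < ⊤) ∧ (∫⁻ x, ‖iteratedFDeriv ℝ 1 v x‖ₑ ^ 2 < ⊤) ∧
    (∫⁻ x, ‖iteratedFDeriv ℝ 2 v x‖ₑ ^ 2 < ⊤)

/-- PARABOLIC REGULARITY at budget `A` (the class of 28317): `‖Dʲv‖_∞ ≤ A_j · M · λ^{-j}` for every `j`. -/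
def IsReg (A : ℕ → ℝ) (v : E3 → E3) (M : ℝ) : Prop :=
  ∀ (j : ℕ) (x : E3), ‖iteratedFDeriv ℝ j v x‖ ≤ A j * M * (lam v)⁻¹ ^ j

/-- `G` is an Euler–Lagrange DENSITY for `v` at level `M`: continuous, and `ℓ_v(curl η) = ∫⟪G, η⟫` for every test field `η`
(existence: the landed `KStar.exists_density` with `c_J = 2J`, `c_a = −2κ⋆²M²W`, `c_c = −2κ⋆²M²Z`, see `isDensity_exists`). -/
def IsDensity (v : E3 → E3) (M : ℝ) (G : E3 → E3) : Prop :=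
  Continuous G ∧ ∀ η : E3 → E3, ContDiff ℝ ∞ η → HasCompactSupport η → ell v M (curl η) = ∫ x, ⟪G x, η x⟫_ℝ

/-- Densities exist (landed `exists_density`, repackaged). -/
theorem isDensity_exists {v : E3 → E3} (hv : ContDiff ℝ ∞ v) (M : ℝ) : ∃ G, IsDensity v M G := by
  obtain ⟨G, hGc, hG⟩ := exists_density hv (2 * Jst v) (-(2 * kStar ^ 2 * M ^ 2 * Wpa v)) (-(2 * kStar ^ 2 * M ^ 2 * Zen v))
  refine ⟨G, hGc, fun η hη hηc => ?_⟩
  have h := hG η hη hηc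
  simp only [ell, J1, A1, C1]
  rw [← h]
  ring

/-! ### §0b The positivity budget is GLOBAL and DEFINITE (proved): `ℓ_v(v) = 6J² − 4κ⋆²M²ZW`, hence
`ℓ_v(v) ≥ 2κ⋆(κ⋆ − 6ε)·M²ZW` on `(κ⋆ − ε)`-efficient fields — the sup-norm constraint is ACTIVE with multiplier mass
`≈ 4κ⋆²M²ZW`; K3 (`EfficientCore`) asks to LOCALISE a definite fraction of it to one ball at scale `R₀(A)λ`.
(Read-back note for 28317, critic N2: `M` is ANY upper bound of `‖v‖`; near-extremality pins `M ≤ κ⋆/(κ⋆−ε)·sup‖v‖`,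
which is why `ε` is chosen AFTER `δ` in 28317 and in `RegularisedNearPlateauStability_of` below.) -/

theorem J1_self (v : E3 → E3) : J1 v v = 3 * Jst v := by
  simp only [J1, Jst, ← integral_const_mul]
  refine integral_congr_ae (Filter.Eventually.of_forall fun x => ?_)
  ring

theorem A1_self (v : E3 → E3) : A1 v v = Zen v := by
  simp only [A1, Zen]
  refine integral_congr_ae (Filter.Eventually.of_forall fun x => ?_)
  simp only [real_inner_self_eq_norm_sq]

theorem C1_self (v : E3 → E3) : C1 v v = Wpa v := by
  simp only [C1, Wpa]
  refine integral_congr_ae (Filter.Eventually.of_forall fun x => ?_)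
  simp only [real_inner_self_eq_norm_sq, frobeniusNormSq_eq_sum (EuclideanSpace.basisFun (Fin 3) ℝ)]

/-- `ℓ_v(v) = 6J² − 4κ⋆²M²ZW`. -/
theorem ell_self (v : E3 → E3) (M : ℝ) : ell v M v = 6 * Jst v ^ 2 - 4 * kStar ^ 2 * M ^ 2 * Zen v * Wpa v := by
  simp only [ell, J1_self, A1_self, C1_self]
  ring

/-- On a `(κ⋆ − ε)`-efficient field the first variation along `v` itself is bounded below by a definite multiple of
`M²ZW`: `2κ⋆(κ⋆ − 6ε)·M²·Z·W ≤ ℓ_v(v)` (for `0 ≤ κ⋆ − ε`, `0 ≤ M`). -/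
theorem ell_self_lower {v : E3 → E3} {M ε : ℝ} (hε : 0 ≤ kStar - ε) (hM : 0 ≤ M)
    (heff : (kStar - ε) * M * Real.sqrt (Zen v) * Real.sqrt (Wpa v) ≤ |Jst v|) :
    2 * kStar * (kStar - 6 * ε) * M ^ 2 * Zen v * Wpa v ≤ ell v M v := by
  have hZ : 0 ≤ Zen v := integral_nonneg fun x => by positivity
  have hW : 0 ≤ Wpa v := integral_nonneg fun x => frobeniusNormSq_nonneg _
  have h0 : 0 ≤ (kStar - ε) * M * Real.sqrt (Zen v) * Real.sqrt (Wpa v) := by positivity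
  have hsq : ((kStar - ε) * M * Real.sqrt (Zen v) * Real.sqrt (Wpa v)) ^ 2 ≤ Jst v ^ 2 := by
    calc ((kStar - ε) * M * Real.sqrt (Zen v) * Real.sqrt (Wpa v)) ^ 2 ≤ |Jst v| ^ 2 := by gcongr
      _ = Jst v ^ 2 := sq_abs _
  have hexp : ((kStar - ε) * M * Real.sqrt (Zen v) * Real.sqrt (Wpa v)) ^ 2
      = (kStar - ε) ^ 2 * M ^ 2 * Zen v * Wpa v := by
    rw [show ((kStar - ε) * M * Real.sqrt (Zen v) * Real.sqrt (Wpa v)) ^ 2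
        = (kStar - ε) ^ 2 * M ^ 2 * (Real.sqrt (Zen v)) ^ 2 * (Real.sqrt (Wpa v)) ^ 2 by ring,
      Real.sq_sqrt hZ, Real.sq_sqrt hW]
  rw [hexp] at hsq
  rw [ell_self]
  have hε' : 0 ≤ ε ^ 2 * M ^ 2 * Zen v * Wpa v := by positivity
  nlinarith [hsq, hε']

/-! ## §1 Stub statements as `Prop`s -/

/-- K2 — DENSITY SUP BOUND in the A-regular class. -/
def DensitySupBound : Prop :=
  ∀ A : ℕ → ℝ, (∀ j, 1 ≤ A j) → ∃ C_G : ℝ, 0 < C_G ∧ ∀ (v : E3 → E3) (M B : ℝ), IsAdm v M B → IsReg A v M →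
    0 < M * Real.sqrt (Zen v) * Real.sqrt (Wpa v) →
      ∃ G : E3 → E3, IsDensity v M G ∧ ∀ x, ‖G x‖ ≤ C_G * M ^ 3 * Wpa v * (lam v)⁻¹ ^ 3

/-- K3 — EFFICIENT CORE of a near-maximiser at scale `R₀(A)·λ` (the open heart of the crux).
The centre `x₀` is FREE (not tied to a maximum point of `‖v‖`): K14 then locates the near-plateau inside THAT ball,
which is all 28317 asks. `η` is dimensionally a vector potential (`‖Dʲη‖ ≤ D_j·M·λ·λ^{-j}`, so `curl η` is velocity-sized);
`σ₀` and `D` are meaningful only relative to each other (ℓ is linear in `η`), both fixed before `v`.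
Attack sketch and the precise obstruction (return flow of a compactly supported potential on partially filled balls):
see the line card `Lines/bangbang_core.md`, § «K3 attack sketch». -/
def EfficientCore : Prop :=
  ∀ A : ℕ → ℝ, (∀ j, 1 ≤ A j) → ∃ (R₀ σ₀ ε₀ : ℝ) (D : ℕ → ℝ), 0 < R₀ ∧ 0 < σ₀ ∧ 0 < ε₀ ∧
    ∀ (v : E3 → E3) (M B : ℝ), IsAdm v M B → IsReg A v M → 0 < M * Real.sqrt (Zen v) * Real.sqrt (Wpa v) →
      (kStar - ε₀) * M * Real.sqrt (Zen v) * Real.sqrt (Wpa v) ≤ |Jst v| →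
        ∃ (x₀ : E3) (η : E3 → E3), ContDiff ℝ ∞ η ∧ tsupport η ⊆ Metric.ball x₀ (R₀ * lam v) ∧
          (∀ (j : ℕ) (x : E3), ‖iteratedFDeriv ℝ j η x‖ ≤ D j * M * lam v * (lam v)⁻¹ ^ j) ∧
          σ₀ * M ^ 4 * Wpa v * lam v ≤ ell v M (curl η)

/-- K1 + K4 — LOCAL BANG-BANG ALTERNATIVE: slack Fermat for two-sided admissible directions + the level-set split. -/
def LocalBangBang : Prop :=
  ∀ (A D : ℕ → ℝ) (R₀ C_G : ℝ), (∀ j, 1 ≤ A j) → 0 < R₀ → 0 < C_G → ∃ C_K : ℝ, 0 < C_K ∧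
    ∀ (τ ε σ : ℝ), 0 < τ → τ ≤ 1 / 4 → 0 ≤ ε →
      ∀ (v : E3 → E3) (M B : ℝ), IsAdm v M B → IsReg A v M → 0 < M * Real.sqrt (Zen v) * Real.sqrt (Wpa v) →
        (kStar - ε) * M * Real.sqrt (Zen v) * Real.sqrt (Wpa v) ≤ |Jst v| →
          ∀ G : E3 → E3, IsDensity v M G → (∀ x, ‖G x‖ ≤ C_G * M ^ 3 * Wpa v * (lam v)⁻¹ ^ 3) →
            ∀ (x₀ : E3) (η : E3 → E3), ContDiff ℝ ∞ η → tsupport η ⊆ Metric.ball x₀ (R₀ * lam v) →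
              (∀ (j : ℕ) (x : E3), ‖iteratedFDeriv ℝ j η x‖ ≤ D j * M * lam v * (lam v)⁻¹ ^ j) →
                σ * M ^ 4 * Wpa v * lam v ≤ ell v M (curl η) →
                  ENNReal.ofReal ((σ - C_K * (Real.sqrt ε + ε) / τ ^ 8) / C_K * lam v ^ 3) ≤
                    volume {x : E3 | x ∈ Metric.ball x₀ (R₀ * lam v) ∧ (1 - 3 * τ) * M ≤ ‖v x‖}

/-! ## §2 Registered stubs (the only `sorry`s of the file; statements = §1 unfolded one level) -/

/-- K2 — density sup bound (`density_formula` + A-regularity up to six derivatives + `|J| ≤ κ⋆M√Z√W` + `Z = λ²W`). [folklore] -/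
theorem stub_densitySupBound :
    ∀ A : ℕ → ℝ, (∀ j, 1 ≤ A j) → ∃ C_G : ℝ, 0 < C_G ∧ ∀ (v : E3 → E3) (M B : ℝ), IsAdm v M B → IsReg A v M →
      0 < M * Real.sqrt (Zen v) * Real.sqrt (Wpa v) →
        ∃ G : E3 → E3, IsDensity v M G ∧ ∀ x, ‖G x‖ ≤ C_G * M ^ 3 * Wpa v * (lam v)⁻¹ ^ 3 := by
  sorry

/-- K3 — efficient core (OPEN; the quantitative localisation of the active sup-norm constraint). [folklore] -/
theorem stub_efficientCore :
    ∀ A : ℕ → ℝ, (∀ j, 1 ≤ A j) → ∃ (R₀ σ₀ ε₀ : ℝ) (D : ℕ → ℝ), 0 < R₀ ∧ 0 < σ₀ ∧ 0 < ε₀ ∧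
      ∀ (v : E3 → E3) (M B : ℝ), IsAdm v M B → IsReg A v M → 0 < M * Real.sqrt (Zen v) * Real.sqrt (Wpa v) →
        (kStar - ε₀) * M * Real.sqrt (Zen v) * Real.sqrt (Wpa v) ≤ |Jst v| →
          ∃ (x₀ : E3) (η : E3 → E3), ContDiff ℝ ∞ η ∧ tsupport η ⊆ Metric.ball x₀ (R₀ * lam v) ∧
            (∀ (j : ℕ) (x : E3), ‖iteratedFDeriv ℝ j η x‖ ≤ D j * M * lam v * (lam v)⁻¹ ^ j) ∧
            σ₀ * M ^ 4 * Wpa v * lam v ≤ ell v M (curl η) := by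
  sorry

/-- K1 + K4 — local bang-bang alternative (slack Fermat + level-set split against the density sup bound). [folklore] -/
theorem stub_localBangBang :
    ∀ (A D : ℕ → ℝ) (R₀ C_G : ℝ), (∀ j, 1 ≤ A j) → 0 < R₀ → 0 < C_G → ∃ C_K : ℝ, 0 < C_K ∧
      ∀ (τ ε σ : ℝ), 0 < τ → τ ≤ 1 / 4 → 0 ≤ ε →
        ∀ (v : E3 → E3) (M B : ℝ), IsAdm v M B → IsReg A v M → 0 < M * Real.sqrt (Zen v) * Real.sqrt (Wpa v) →
          (kStar - ε) * M * Real.sqrt (Zen v) * Real.sqrt (Wpa v) ≤ |Jst v| →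
            ∀ G : E3 → E3, IsDensity v M G → (∀ x, ‖G x‖ ≤ C_G * M ^ 3 * Wpa v * (lam v)⁻¹ ^ 3) →
              ∀ (x₀ : E3) (η : E3 → E3), ContDiff ℝ ∞ η → tsupport η ⊆ Metric.ball x₀ (R₀ * lam v) →
                (∀ (j : ℕ) (x : E3), ‖iteratedFDeriv ℝ j η x‖ ≤ D j * M * lam v * (lam v)⁻¹ ^ j) →
                  σ * M ^ 4 * Wpa v * lam v ≤ ell v M (curl η) →
                    ENNReal.ofReal ((σ - C_K * (Real.sqrt ε + ε) / τ ^ 8) / C_K * lam v ^ 3) ≤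
                      volume {x : E3 | x ∈ Metric.ball x₀ (R₀ * lam v) ∧ (1 - 3 * τ) * M ≤ ‖v x‖} := by
  sorry

/-! ### Registered-stub aliases (hypothesis heads matched by name by `#h21_check_skeleton`) -/
namespace Registered

/-- Statement of registered stub K2. -/
abbrev stub_densitySupBound : Prop := DensitySupBound
/-- Statement of registered stub K3. -/
abbrev stub_efficientCore : Prop := EfficientCore
/-- Statement of registered stub K1+K4. -/
abbrev stub_localBangBang : Prop := LocalBangBang

end Registered

/-! ## §3 Composition (real proofs, no `sorry` below this line) -/

/-- **K2 → K3 → K14 → `RegularisedNearPlateauStability` (28317, BY NAME)** — the quantitative bang-bang assembled: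
`c₀ = σ₀/(2 C_K R₀³)`, `r = R₀`, `τ = min δ (3/4) / 3`, `ε = min (min ε₀ 1) (σ₀τ⁸/(4C_K))²`. -/
theorem RegularisedNearPlateauStability_of
    (h2 : Registered.stub_densitySupBound) (h3 : Registered.stub_efficientCore) (h4 : Registered.stub_localBangBang) :
    Summit.NavierStokesRegularity.NavierStokesRegularity.Theses.ExtremiserTransience.RegularisedNearPlateauStability := by
  have h2' : DensitySupBound := h2
  have h3' : EfficientCore := h3
  have h4' : LocalBangBang := h4
  intro A hA
  obtain ⟨C_G, hCG, hG⟩ := h2' A hA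
  obtain ⟨R₀, σ₀, ε₀, D, hR₀, hσ₀, hε₀, hcore⟩ := h3' A hA
  obtain ⟨C_K, hCK, hbb⟩ := h4' A D R₀ C_G hA hR₀ hCG
  refine ⟨σ₀ / (2 * C_K * R₀ ^ 3), R₀, by positivity, hR₀, ?_⟩
  intro δ hδ
  -- the margin `τ` and the slack `ε`
  set τ : ℝ := min δ (3 / 4) / 3 with hτdef
  have hτpos : 0 < τ := by
    have : 0 < min δ (3 / 4) := lt_min hδ (by norm_num)
    rw [hτdef]; linarith
  have hτle : τ ≤ 1 / 4 := by
    have : min δ (3 / 4) ≤ 3 / 4 := min_le_right _ _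
    rw [hτdef]; linarith
  have h3τ : 3 * τ ≤ δ := by
    have : min δ (3 / 4) ≤ δ := min_le_left _ _
    rw [hτdef]; linarith
  set e₁ : ℝ := σ₀ * τ ^ 8 / (4 * C_K) with he₁def
  have he₁pos : 0 < e₁ := by rw [he₁def]; positivity
  set ε : ℝ := min (min ε₀ 1) (e₁ ^ 2) with hεdef
  have hεpos : 0 < ε := lt_min (lt_min hε₀ one_pos) (pow_pos he₁pos 2)
  have hεε₀ : ε ≤ ε₀ := (min_le_left _ _).trans (min_le_left _ _)
  have hε1 : ε ≤ 1 := (min_le_left _ _).trans (min_le_right _ _)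
  have hεsq : ε ≤ e₁ ^ 2 := min_le_right _ _
  have hsqrt : Real.sqrt ε ≤ e₁ := by
    calc Real.sqrt ε ≤ Real.sqrt (e₁ ^ 2) := Real.sqrt_le_sqrt hεsq
      _ = e₁ := Real.sqrt_sq he₁pos.le
  have hεle : ε ≤ Real.sqrt ε := by
    have h := Real.sqrt_le_sqrt hε1
    rw [Real.sqrt_one] at h
    calc ε = Real.sqrt ε * Real.sqrt ε := (Real.mul_self_sqrt hεpos.le).symm
      _ ≤ Real.sqrt ε * 1 := by gcongr
      _ = Real.sqrt ε := mul_one _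
  refine ⟨ε, hεpos, ?_⟩
  intro v M B hv hdiv hM hB h0 h1 h2i hreg hpos heff
  have hadm : IsAdm v M B := ⟨hv, hdiv, hM, hB, h0, h1, h2i⟩
  have hreg' : IsReg A v M := hreg
  have hpos' : 0 < M * Real.sqrt (Zen v) * Real.sqrt (Wpa v) := hpos
  have heff' : (kStar - ε) * M * Real.sqrt (Zen v) * Real.sqrt (Wpa v) ≤ |Jst v| := heff
  have heff₀ : (kStar - ε₀) * M * Real.sqrt (Zen v) * Real.sqrt (Wpa v) ≤ |Jst v| := by
    refine le_trans ?_ heff'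
    have hk : kStar - ε₀ ≤ kStar - ε := by linarith
    have := mul_le_mul_of_nonneg_right hk hpos'.le
    calc (kStar - ε₀) * M * Real.sqrt (Zen v) * Real.sqrt (Wpa v)
        = (kStar - ε₀) * (M * Real.sqrt (Zen v) * Real.sqrt (Wpa v)) := by ring
      _ ≤ (kStar - ε) * (M * Real.sqrt (Zen v) * Real.sqrt (Wpa v)) := this
      _ = (kStar - ε) * M * Real.sqrt (Zen v) * Real.sqrt (Wpa v) := by ring
  obtain ⟨x₀, η, hη, hsupp, hD, hell⟩ := hcore v M B hadm hreg' hpos' heff₀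
  obtain ⟨G, hGd, hGsup⟩ := hG v M B hadm hreg' hpos'
  have hvol := hbb τ ε σ₀ hτpos hτle hεpos.le v M B hadm hreg' hpos' heff' G hGd hGsup x₀ η hη hsupp hD hell
  have hM0 : 0 ≤ M := le_trans (norm_nonneg _) (hM x₀)
  -- the slack is at most half the core efficiency
  have hslack : C_K * (Real.sqrt ε + ε) / τ ^ 8 ≤ σ₀ / 2 := by
    have hτ8 : 0 < τ ^ 8 := pow_pos hτpos 8
    rw [div_le_iff₀ hτ8]
    have h1 : Real.sqrt ε + ε ≤ 2 * e₁ := by linarith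
    calc C_K * (Real.sqrt ε + ε) ≤ C_K * (2 * e₁) := by gcongr
      _ = σ₀ / 2 * τ ^ 8 := by rw [he₁def]; field_simp; ring
  have hreal : σ₀ / (2 * C_K * R₀ ^ 3) * (R₀ * lam v) ^ 3 ≤
      (σ₀ - C_K * (Real.sqrt ε + ε) / τ ^ 8) / C_K * lam v ^ 3 := by
    have hlam : 0 ≤ lam v := Real.sqrt_nonneg _
    have hlam3 : 0 ≤ lam v ^ 3 := pow_nonneg hlam 3
    have hlhs : σ₀ / (2 * C_K * R₀ ^ 3) * (R₀ * lam v) ^ 3 = σ₀ / 2 / C_K * lam v ^ 3 := by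
      field_simp
    rw [hlhs]
    have : σ₀ / 2 ≤ σ₀ - C_K * (Real.sqrt ε + ε) / τ ^ 8 := by linarith
    gcongr
  refine ⟨x₀, ?_⟩
  calc ENNReal.ofReal (σ₀ / (2 * C_K * R₀ ^ 3) * (R₀ * Real.sqrt ((∫ x, ‖curl v x‖ ^ 2) /
          (∫ x, frobeniusNormSq (fderiv ℝ (curl v) x)))) ^ 3)
      ≤ ENNReal.ofReal ((σ₀ - C_K * (Real.sqrt ε + ε) / τ ^ 8) / C_K * lam v ^ 3) := ENNReal.ofReal_le_ofReal hreal
    _ ≤ volume {x : E3 | x ∈ Metric.ball x₀ (R₀ * lam v) ∧ (1 - 3 * τ) * M ≤ ‖v x‖} := hvol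
    _ ≤ volume {x : E3 | x ∈ Metric.ball x₀ (R₀ * Real.sqrt ((∫ x, ‖curl v x‖ ^ 2) /
          (∫ x, frobeniusNormSq (fderiv ℝ (curl v) x)))) ∧ (1 - δ) * M ≤ ‖v x‖} := by
        refine measure_mono fun x hx => ⟨hx.1, le_trans ?_ hx.2⟩
        exact mul_le_mul_of_nonneg_right (by linarith) hM0

/-- **COMPOSITION (the skeleton theorem, kernel-checked).** K2 → K3 → K14 → (support item `RegularisedSliceTransfer`, 28318, BY
NAME) → the crux `NearExtremalTransiencePerFlow` BY NAME: the regularised near-plateau stability assembled above feeds the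
transfer, whose weak-class slice object is excluded by the landed `plateauSliceRigidity`. -/
theorem NearExtremalTransiencePerFlow_of
    (h2 : Registered.stub_densitySupBound) (h3 : Registered.stub_efficientCore) (h4 : Registered.stub_localBangBang)
    (hT : Summit.NavierStokesRegularity.NavierStokesRegularity.Theses.ExtremiserTransience.RegularisedSliceTransfer) :
    Summit.NavierStokesRegularity.NavierStokesRegularity.Theses.ExtremiserTransience.NearExtremalTransiencePerFlow := by
  intro C ν T hC0 hν hT0 u p hsol hLH hdec hrate hne
  by_contra hno
  exact plateauSliceRigidity
    (hT (RegularisedNearPlateauStability_of h2 h3 h4) C ν T hC0 hν hT0 u p hsol hLH hdec hrate hne hno)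

/-- How the closed proof is obtained once the three stubs (and the support item 28318, LINE g6-β) land. -/
example (hT : Summit.NavierStokesRegularity.NavierStokesRegularity.Theses.ExtremiserTransience.RegularisedSliceTransfer) :
    Summit.NavierStokesRegularity.NavierStokesRegularity.Theses.ExtremiserTransience.NearExtremalTransiencePerFlow :=
  NearExtremalTransiencePerFlow_of stub_densitySupBound stub_efficientCore stub_localBangBang hT

end Summit.NavierStokesRegularity.NavierStokesRegularity.Cruxes.NearExtremalTransiencePerFlow.BangBangCore

end
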